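import Literature.MathematicalPhysics.QuantumFieldTheory.Balaban1983to89.B8Prop6CubeMemberFlat
import Literature.MathematicalPhysics.QuantumFieldTheory.Balaban1983to89.B8Eq142KLevelLocal

/-!
# `Balaban1983to89.B8Prop6CubeMemberEq137` — [Balaban1985RegularSpaces] PROPOSITION 6 (p. 99), THE IDENTITY OF (1.137)
# «Q_k(ηA) = (1∕i) log Ū₀′ᵏ on □^{(k)}» AT THE CONCRETE CUBE MEMBER, in the tree's currency `Q_j(U₀, B) = B7Prop4GeneralLevels.logCovIter`

statement-level skeleton of published theorems with citation tags; proofs where landed; nothing here is a claim about the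
Yang–Mills mass gap

T. Bałaban, *Spaces of regular gauge field configurations on a lattice and gauge fixing conditions*, Commun. Math. Phys. **99**
(1985) 75–102 `[Balaban1985RegularSpaces]` ("B8"), Sect. F p. 99, Proposition 6 (1.137); Theorem 2 (1.37) p. 82; [3] = T. Bałaban,
*Averaging operations for lattice gauge theories*, Commun. Math. Phys. **98** (1985) 17–51 `[Balaban1985Averaging]` (127) p. 37, (87) p. 31,
p. 24 (locality of (43)).

CITATION HEADER (lean-in-tree rule).  Cell `pub-ymgap` (YM Track A, HUMAN RULING D-0062), DAG node N05 = [B8], seat `pub-ymgap-dag-n05-e`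
(R141 (C) fan-out; FAN-OUT v1.1 §N05 row s3b «Proposition 6 at the CONCRETE cube family», module 3a of the n05-c ∕ n05-e division).
WHY: the kernel half of row s3b (`B8Prop6CubeMember` ∕ `B8Prop6CubeMemberFlat`, seat n05-c) lands Proposition 6's gauge transformation `u`
at the cube member with (1.29), (1.38) of record, the (1.62)-shape and (1.135).  Of (1.137), the INEQUALITIES «|(1∕i) log Ū₀′ᵏ(x, x′)| <
|x − y|4α₀ ≤ 2dMα₀» are certified for this `U₀′` outright by `B8Prop6OfThm4.ineq137_cube`; the IDENTITY «Q_k(ηA) = (1∕i) log Ū₀′ᵏ on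
□^{(k)}» was left inside the abstract `Concl` there (HONEST SCOPE).  THIS MODULE certifies the identity at the member: it is the level-`k`,
interior-bond case of Theorem 2's line (1.37) «Q_j(U₀, ηA) = B on Λ_j» at the background `U₀ = 1` (p. 99: «The functions and derivatives
above are defined without any external gauge field configuration (or the configuration is equal to 1)»), `B = (1∕i) log Ũ′ᵏ = (1∕i) log Ū′ᵏ`
((1.31) first line; `Ũ′ = Ū′` at background `1`), `U′ = U₀″`, and `Ū₀″ᵏ = Ū₀′ᵏ` on `□^{(k)}` by locality.  Kind «kernel-checked proof»,
theorems only, no `def`, no socket: the identity needs NO Proposition-5 ∕ [4] input — only (1.132)'s axial class for `U₀″`, (1.29) for `u`,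
the representation `U₁ = e^{iηA}` with (1.62)'s bound on `□`, and [3] Prop. 4's regime for `Lᵏη|A|`.

WHAT IS PRINTED (p. 99, verbatim; the whole Proposition is quoted in `B8Prop6OfThm4`): *"Q_k(ηA) = (1∕i) log Ū₀′ᵏ on □^{(k)},
|(1∕i) log Ū₀′ᵏ(x, x′)| < |x − y|4α₀ ≤ 2dMα₀ for ⟨x, x′⟩ ⊂ □^{(k)}, y is a center of □, (1.137)"*; p. 82 (1.37): *"Q_j(U₀, ηA) = B on
Λ_j, j = 0, 1, …, k, B is given by formula (1.31) with V′ = Ũ′ʲ"*, (1.31) first line *"(Ū₁ʲ)_b = V′_b = exp iB_b, if b ⊂ Λ_j"*.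

DICTIONARY (nothing new; the `ℤᵈ` model of the N05 lineage).  `Q_j(U₀, ηA)` ↦ `logCovIter L U₀ (iEta η A) j` (the `i`-multiplied object,
`B7Prop4GeneralLevels` ∕ `B8Eq137QjEqB`), so print's identity reads `logCovIter L 1 (iEta η A) k x μ = log (Ū₀′ᵏ(x, μ))` (`MatrixLog.mlog`;
both sides `i`·print's); `U₀′ = gaugeAct (localGauge …) U₀`, `U₀″ = B8Ineq133.cutFixed …`, `U₁ = U₀″^{u⁻¹} = gaugeAct u⁻¹ U₀″`; `□^{(k)} =
[a, a + M − 1]ᵈ`: the bonds `⟨x, x + e_μ⟩` with `bLo L a 0 0 ≤ x`, `x + e_μ ≤ bHi L a M 0 0` (as in `ineq137_cube`); `{□_j} =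
B8Eq131CubesAdmissible.cubeFam false …`, restriction sets `B8CubeMemberZd.cubeLamS … k` (`Λ_k = □_k^{(k)}`).

WHAT THIS MODULE PROVES (kernel, 0 sorry).
§1 `exists_flat_window` (at the background `1` the (1.40)-parameter of [3] Prop. 4's regime is free; a choice with `e^{c(d)α} ≤ 4∕3`);
   **`logCovIter_one_eq_mlog_avgIter_loc`** — THE GENERIC TOWER-LOCAL IDENTITY AT BACKGROUND `1` (level `j + 1`, one bond `c = ⟨y, y + e_κ⟩`):
   if on the fine box `B^{j+1}(c₋) ∪ B^{j+1}(c₊)` the field is `U₁ = e^{B}` with `‖B‖ ≤ b`, `L^{j+1}b` in [3] Prop. 4's window, and `u`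
   satisfies (87) of [3] at `c₋`, `c₊` for the pair `(1, U₁)`, then `Q_{j+1}(1, B)(c) = log (Ū′^{j+1}(c))`, `U′ = U₁^{u}` — the global lemma
   `B8Eq137QjEqB.Qj_eq_Bint_regular` (`pdev 1 = 0`) for the box-restricted exponent field, transported by the locality of `Q_{j+1}`
   (`B7LocalityGeneral.logCovIter_congr`), of the frames (85) (`B8Ineq172Concrete.wrec_congr_tower`) and of the `(j+1)`-fold average
   (`B7Prop1Local.avgIter_congr`) — the pattern of `B8Eq142KLevelLocal.norm_Qj_lt_interior_loc`; `…_of_window` — the `α`-free window.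
§2 geometry of `□^{(k)}` in the member: `mem_cubeLamS_top_of_sq` (ends of a bond of `□^{(k)}` lie in `Λ_k`), `mem_box_of_bondBox` ∕
   `mem_cubeFam_top_of_bondBox` (its fine box lies in `□ ⊂ □_k = Ω_k`), `sideTouches_top_of_bondBox`.
§3 **`logCovIter_eq_mlog_avgIter_cubeMember`** — THE IDENTITY OF (1.137) AT THE MEMBER: for the datum of Sect. F (as in
   `B8Prop6CubeMember.thm4_hypotheses_one_cutFixed`), ANY `u` with (1.29) `Restr129 L k (cubeLamS … k) 1 u` and any `A` with `U₀″^{u⁻¹} =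
   e^{iηA}`, `|A| ≤ α₂(Lᵏη)⁻¹` on the bonds of the plaquettes touching `□_k` (the (1.62)-shape at the top level, as landed by
   `B8Prop6CubeMemberFlat.prop6_exists_cubeMember_at`), `16·131072(d+1)²α₂ ≤ 1`, `2α₂ ≤ c₃(d, L)`: `Q_k(1, iηA)(x, μ) = log Ū₀″ᵏ(x, μ)` on
   `□^{(k)}`; **`eq137_cubeMember`** — print's (1.137) complete at the member: the identity with `Ū₀′ᵏ`, `Ū₀″ᵏ = Ū₀′ᵏ` on `□^{(k)}`, and
   `‖(1∕i) log Ū₀′ᵏ(x, x + e_μ)‖ ≤ |x − y|₁·4α₀ ≤ 2dMα₀` (`B8Prop6OfThm4.ineq137_cube` BY NAME).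

HONEST SCOPE.  (i) `ℤᵈ` carriers; `𝔸` a C⋆-algebra in §3 (complete normed `ℂ`-algebra with `‖1‖ = 1` in §1).  (ii) The identity is
proved for the `u`, `A` DISPLAYED as hypotheses; their existence at the member is n05-c's `prop6_exists_cubeMember_at` ∕
`prop6_asPrinted_cubeMember_at` modulo the four socket bodies — NOT re-derived or discharged here.  (iii) The window on `α₂` is [3] Prop. 4's
regime at the flat background (`log ∘ exp = id` level by level); with `α₂ = 7dL²B₁Mα₀` it is a further smallness `7dL²Mα₀ ≤ c(d, L, B₀)`,
absorbed into the threshold by the packaging module.  (iv) print's `<` is `≤` as in `ineq137_cube`.  Count-neutral; N05 NOT discharged;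
nothing continuum ∕ ℝ⁴ ∕ OS ∕ mass-gap ∕ Clay.  Unit `pub-ymgap-dag-n05-e` (g0), 2026-08-26.
-/

noncomputable section

open NormedSpace

namespace Literature.MathematicalPhysics.QuantumFieldTheory.Balaban1983to89.B8Prop6CubeMemberEq137

open Complex (I)
open MatrixLog B7Prop1Explicit B7Prop2Explicit B7Prop1Local B7Eq92Concrete B7Eq99Concrete
open B7Prop3Flat (expCfg c3 c3_pos insCfg)
open B7Prop4GeneralLevels (logCovIter)
open B7Prop5Flat (bondsIn restr mem_bondsIn insCfg_restr_of_mem agreeOn_insCfg_restr BondIn)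
open B7LocalityGeneral (logCovIter_congr)
open B7AvgGaugeCovariance (uLev)
open B8Ineq130 (tlo thi tlo_apply thi_apply gaugeAct_one hol_one)
open B8Ineq132 (InAk BondTouches)
open B8Ineq133 (cutFixed)
open B8Lemma1NonAbelian (mulCfg)
open B8Eq115GaugeFixing (localGauge gaugeAct_mul gaugeAct_agree)
open B8Eq146AExpansion (iEta)
open B8Eq184Proof (cfgExp)
open B8Eq140Level (SideTouches sideTouches_of_bondTouches)
open B8Eq119TwistedAxial (InAx Restr129)
open B8Eq131Derivation (eq87_of_inAx_restr129)
open B8Eq137QjEqB (Qj_eq_Bint_regular)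
open B8Thm2LogB (Bint)
open B8Ineq172Concrete (wrec_congr_tower)
open B8Eq131Cubes (bLo bHi box tcube tLo tHi ctr sqLo sqHi gs box_subset_cube_top)
open B8Eq131CubesAdmissible (cubeFam cubeFam_false_of_le)
open B8CubeMemberZd (cubeLamS cubeLamS_self)
open B8Prop6CubeMember (thm4_hypotheses_one_cutFixed)
open B8Prop6OfThm4 (ineq137_cube)

-- `Site` alone could resolve to the torus sites of `Setup.lean`; re-export the `ℤ^d` sites of `B7Prop1Explicit`.
export B7Prop1Explicit (Site)

variable {d : ℕ}

/-! ## §1 The generic tower-local identity `Q_{j+1}(1, B)(c) = log Ū′^{j+1}(c)` at the background `1` -/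

section Generic

/-- **At the background `1` the (1.40)-parameter of [3] Prop. 4's regime is free**: there is `α > 0` with `C₀α ≤ 1∕3`, `4α ≤ c₂′`,
and `exp(4·800(d+1)²(d+4)·α) ≤ 4∕3` (so that the window `e^{…α}(1 + 8·131072(d+1)²·Lᵏb) ≤ 2` follows from `16·131072(d+1)²·Lᵏb ≤ 1`).
[cite: Balaban1985Averaging, Prop. 4 p.38 (the regime), p.37 (after (127))] -/
theorem exists_flat_window (d : ℕ) {L : ℕ} (hL : 1 ≤ L) :
    ∃ α : ℝ, 0 < α ∧ C0 d * α ≤ 1 / 3 ∧ 4 * α ≤ c2' d L ∧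
      Real.exp (4 * (800 * ((d : ℝ) + 1) ^ 2 * ((d : ℝ) + 4)) * α) ≤ 4 / 3 := by
  have hC0 := C0_pos d
  have hc2 := c2'_pos d L hL
  set c : ℝ := 4 * (800 * ((d : ℝ) + 1) ^ 2 * ((d : ℝ) + 4)) with hc
  have hcpos : 0 < c := by positivity
  have hlog : 0 < Real.log (4 / 3) := Real.log_pos (by norm_num)
  refine ⟨min (Real.log (4 / 3) / c) (min (1 / (3 * C0 d)) (c2' d L / 4)), ?_, ?_, ?_, ?_⟩
  · exact lt_min (div_pos hlog hcpos) (lt_min (by positivity) (by positivity))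
  · calc C0 d * min (Real.log (4 / 3) / c) (min (1 / (3 * C0 d)) (c2' d L / 4))
          ≤ C0 d * (1 / (3 * C0 d)) :=
            mul_le_mul_of_nonneg_left ((min_le_right _ _).trans (min_le_left _ _)) hC0.le
      _ = 1 / 3 := by field_simp
  · calc 4 * min (Real.log (4 / 3) / c) (min (1 / (3 * C0 d)) (c2' d L / 4))
          ≤ 4 * (c2' d L / 4) := mul_le_mul_of_nonneg_left ((min_le_right _ _).trans (min_le_right _ _)) (by norm_num)
      _ = c2' d L := by ring
  · calc Real.exp (c * min (Real.log (4 / 3) / c) (min (1 / (3 * C0 d)) (c2' d L / 4)))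
          ≤ Real.exp (c * (Real.log (4 / 3) / c)) :=
            Real.exp_le_exp.2 (mul_le_mul_of_nonneg_left (min_le_left _ _) hcpos.le)
      _ = 4 / 3 := by rw [mul_div_cancel₀ _ hcpos.ne', Real.exp_log (by norm_num)]

variable {𝔸 : Type*} [NormedRing 𝔸] [NormOneClass 𝔸] [NormedAlgebra ℂ 𝔸] [CompleteSpace 𝔸]

omit [NormOneClass 𝔸] [NormedAlgebra ℂ 𝔸] [CompleteSpace 𝔸] in
/-- The restriction `B|_{box}` (zero outside the bonds of the box) is bounded by a common bound of `B` on the box's bonds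
(private plumbing, as in `B8Eq142KLevelLocal`). [folklore] -/
private theorem norm_insCfg_restr_le' {lo hi : Site d} {B : Site d → Fin d → 𝔸} {b : ℝ}
    (hB : ∀ x μ, BondIn lo hi x μ → ‖B x μ‖ ≤ b) (hb : 0 ≤ b) :
    ∀ x μ, ‖insCfg (bondsIn lo hi) (restr (bondsIn lo hi) B) x μ‖ ≤ b := fun x μ => by
  by_cases h : (x, μ) ∈ bondsIn lo hi
  · rw [insCfg_restr_of_mem _ _ h]; exact hB x μ (mem_bondsIn.mp h)
  · simp only [insCfg, h, dite_false, norm_zero]; exact hb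

variable {G : Type*} in
/-- Agreement on a box restricts to agreement on any sub-box (private plumbing). [folklore] -/
private theorem agreeOn_of_subbox {lo hi LO HI : Site d} {V V' : Site d → Fin d → G}
    (hsub : ∀ x, InBox lo hi x → InBox LO HI x) (h : AgreeOn LO HI V V') : AgreeOn lo hi V V' :=
  fun x κ hx hxe => h x κ (hsub x hx) (hsub _ hxe)

omit [NormOneClass 𝔸] [NormedAlgebra ℂ 𝔸] [CompleteSpace 𝔸] in
/-- `pdev 1 = 0`: every plaquette variable of the configuration `1` is `1`. [folklore] -/
private theorem pdev_one' : pdev (1 : Site d → Fin d → 𝔸ˣ) = 0 := by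
  unfold pdev; simp [hol_one]

/-- **THE IDENTITY «Q_j(U₀, ηA) = B on Λ_j» ((1.37) first half; (1.31) first line `B_b = (1∕i) log Ũ′ʲ_b`) AT THE BACKGROUND `U₀ = 1`, ONE
INTERIOR BOND, FROM BOX DATA** (tower-local form of `B8Eq137QjEqB.Qj_eq_Bint_regular` at the flat background, `Ũ′ʲ = Ū′ʲ`): at a bond
`c = ⟨y, y + e_κ⟩` of the `(j+1)`-lattice, if on the fine box `B^{j+1}(c₋) ∪ B^{j+1}(c₊)` the field is `U₁ = e^{B}` (`hU₁`) with `‖B_b‖ ≤ b`,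
`L^{j+1}b` in [3] Prop. 4's window at a free parameter `α` (`hα3`, `hα4`, `hsm`, `hc₃`; cf. `exists_flat_window`), and `u` satisfies (87) of [3]
at `c₋`, `c₊` for the pair `(1, U₁)` (from (1.19)∕(1.29) by `B8Eq131Derivation.eq87_of_inAx_restr129`), THEN `Q_{j+1}(1, B)(c) = log Ū′^{j+1}(c)`,
`U′ = U₁^{u} = gaugeAct u U₁` (both sides `i`·print's).  PROOF: restrict `B` to the box, global lemma (`pdev 1 = 0`), transport back.
[cite: Balaban1985RegularSpaces, (1.37) p.82, (1.31) p.82, Prop. 6 (1.137) p.99; Balaban1985Averaging, (127) p.37, (87) p.31, p.24 (locality)] -/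
theorem logCovIter_one_eq_mlog_avgIter_loc (L : ℕ) (hL : 2 ≤ L) {G : Subgroup 𝔸ˣ} (hG : AvgClosed d L G)
    (j : ℕ) (y : Site d) (κ : Fin d)
    {α : ℝ} (hα : 0 < α) (hα3 : C0 d * α ≤ 1 / 3) (hα4 : 4 * α ≤ c2' d L)
    (B : Site d → Fin d → 𝔸) {b : ℝ} (hb : 0 ≤ b)
    (hB : ∀ x μ, BondIn (loK L (j + 1) y) (bondHiK L (j + 1) y κ) x μ → ‖B x μ‖ ≤ b)
    (hsm : Real.exp (4 * (800 * ((d : ℝ) + 1) ^ 2 * ((d : ℝ) + 4)) * α)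
      * (1 + 8 * (131072 * ((d : ℝ) + 1) ^ 2) * ((L : ℝ) ^ (j + 1) * b)) ≤ 2)
    (hc₃ : 2 * ((L : ℝ) ^ (j + 1) * b) ≤ c3 d L)
    (u : Site d → 𝔸ˣ) (U₁ : Site d → Fin d → 𝔸ˣ)
    (hU₁ : AgreeOn (loK L (j + 1) y) (bondHiK L (j + 1) y κ) U₁ (expCfg B))
    (hm : uLev L u (j + 1) y = (wrec L (1 : Site d → Fin d → 𝔸ˣ) U₁ (j + 1) y)⁻¹)
    (hp : uLev L u (j + 1) (y + e κ) = (wrec L (1 : Site d → Fin d → 𝔸ˣ) U₁ (j + 1) (y + e κ))⁻¹) :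
    logCovIter L (1 : Site d → Fin d → 𝔸ˣ) B (j + 1) y κ = mlog ((avgIter L (gaugeAct u U₁) (j + 1) y κ : 𝔸ˣ) : 𝔸) := by
  have hL1 : 1 ≤ L := le_trans (by norm_num) hL
  set lo := loK L (j + 1) y with hlo
  set hi := bondHiK L (j + 1) y κ with hhi
  -- the restricted exponent field, its global bound, the agreements on the box
  set B' := insCfg (bondsIn lo hi) (restr (bondsIn lo hi) B) with hB'_def
  have hB' : ∀ x μ, ‖B' x μ‖ ≤ b := norm_insCfg_restr_le' hB hb
  have hag1 : AgreeOn lo hi (1 : Site d → Fin d → 𝔸ˣ) (1 : Site d → Fin d → 𝔸ˣ) := fun _ _ _ _ => rfl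
  have hagB : AgreeOn lo hi B B' := agreeOn_insCfg_restr lo hi B
  have hagE : AgreeOn lo hi U₁ (expCfg B') := fun x μ hx hxe => by
    rw [hU₁ x μ hx hxe]
    apply Units.ext
    show exp (B x μ) = exp (B' x μ)
    rw [hagB x μ hx hxe]
  have hw : ∀ z : Site d, (∀ x, InBox (tlo L z (j + 1)) (thi L z (j + 1)) x → InBox lo hi x) →
      wrec L (1 : Site d → Fin d → 𝔸ˣ) U₁ (j + 1) z = wrec L (1 : Site d → Fin d → 𝔸ˣ) (expCfg B') (j + 1) z := by
    intro z hsub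
    exact wrec_congr_tower hL1 (agreeOn_of_subbox hsub hag1) (agreeOn_of_subbox hsub hagE) (j + 1) 0 (by omega) z
      (by rw [B8Ineq130.tlo_zero]) (by rw [B8Ineq130.thi_zero])
  rw [hw y fun x hx => B8Eq142KLevelLocal.inBox_box_of_tower_fst L (j + 1) y κ hx] at hm
  rw [hw (y + e κ) fun x hx => B8Eq142KLevelLocal.inBox_box_of_tower_snd (j + 1) y κ hx] at hp
  have hone : ∀ x μ, (1 : Site d → Fin d → 𝔸ˣ) x μ ∈ G := fun _ _ => G.one_mem
  have hL0 : (0 : ℝ) < L := by exact_mod_cast hL1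
  have h40 : pdev (1 : Site d → Fin d → 𝔸ˣ) < α * (((L : ℝ) ^ (j + 1))⁻¹) ^ 2 := by rw [pdev_one']; positivity
  have key := Qj_eq_Bint_regular L hL hG (j + 1) (1 : Site d → Fin d → 𝔸ˣ) hone hα hα3 hα4 h40 B' hb hB' hsm hc₃ u
    (Nat.le_succ j) y κ hm hp
  rw [tildIter_one_left, mgauge_one_left, Bint, smul_smul, mul_inv_cancel₀ Complex.I_ne_zero, one_smul] at key
  have hav : avgIter L (gaugeAct u (expCfg B')) (j + 1) y κ = avgIter L (gaugeAct u U₁) (j + 1) y κ :=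
    avgIter_congr L hL1 (j + 1) y κ (gaugeAct_agree hagE.symm u)
  rw [hav] at key
  rwa [logCovIter_congr L hL1 (j + 1) y κ hag1 hagB.symm] at key

/-- **The same with the `α`-free window** `16·131072(d+1)²·(L^{j+1}b) ≤ 1`, `2L^{j+1}b ≤ c₃(d, L)` (the flat background's (1.40)-parameter
chosen by `exists_flat_window`). [cite: Balaban1985RegularSpaces, (1.37) p.82, Prop. 6 (1.137) p.99; Balaban1985Averaging, (127) p.37, Prop. 4 p.38] -/
theorem logCovIter_one_eq_mlog_avgIter_loc_of_window (L : ℕ) (hL : 2 ≤ L) {G : Subgroup 𝔸ˣ} (hG : AvgClosed d L G)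
    (j : ℕ) (y : Site d) (κ : Fin d) (B : Site d → Fin d → 𝔸) {b : ℝ} (hb : 0 ≤ b)
    (hB : ∀ x μ, BondIn (loK L (j + 1) y) (bondHiK L (j + 1) y κ) x μ → ‖B x μ‖ ≤ b)
    (h16 : 16 * (131072 * ((d : ℝ) + 1) ^ 2) * ((L : ℝ) ^ (j + 1) * b) ≤ 1)
    (hc₃ : 2 * ((L : ℝ) ^ (j + 1) * b) ≤ c3 d L)
    (u : Site d → 𝔸ˣ) (U₁ : Site d → Fin d → 𝔸ˣ)
    (hU₁ : AgreeOn (loK L (j + 1) y) (bondHiK L (j + 1) y κ) U₁ (expCfg B))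
    (hm : uLev L u (j + 1) y = (wrec L (1 : Site d → Fin d → 𝔸ˣ) U₁ (j + 1) y)⁻¹)
    (hp : uLev L u (j + 1) (y + e κ) = (wrec L (1 : Site d → Fin d → 𝔸ˣ) U₁ (j + 1) (y + e κ))⁻¹) :
    logCovIter L (1 : Site d → Fin d → 𝔸ˣ) B (j + 1) y κ = mlog ((avgIter L (gaugeAct u U₁) (j + 1) y κ : 𝔸ˣ) : 𝔸) := by
  have hL1 : 1 ≤ L := le_trans (by norm_num) hL
  obtain ⟨α, hα, hα3, hα4, hexp⟩ := exists_flat_window d hL1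
  have hLb : 0 ≤ (L : ℝ) ^ (j + 1) * b := by positivity
  have hsm : Real.exp (4 * (800 * ((d : ℝ) + 1) ^ 2 * ((d : ℝ) + 4)) * α)
      * (1 + 8 * (131072 * ((d : ℝ) + 1) ^ 2) * ((L : ℝ) ^ (j + 1) * b)) ≤ 2 := by
    have h1 : 1 + 8 * (131072 * ((d : ℝ) + 1) ^ 2) * ((L : ℝ) ^ (j + 1) * b) ≤ 3 / 2 := by linarith
    have h0 : 0 ≤ 1 + 8 * (131072 * ((d : ℝ) + 1) ^ 2) * ((L : ℝ) ^ (j + 1) * b) := by positivity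
    calc Real.exp (4 * (800 * ((d : ℝ) + 1) ^ 2 * ((d : ℝ) + 4)) * α)
          * (1 + 8 * (131072 * ((d : ℝ) + 1) ^ 2) * ((L : ℝ) ^ (j + 1) * b))
          ≤ (4 / 3) * (3 / 2) := mul_le_mul hexp h1 h0 (by norm_num)
      _ = 2 := by norm_num
  exact logCovIter_one_eq_mlog_avgIter_loc L hL hG j y κ hα hα3 hα4 B hb hB hsm hc₃ u U₁ hU₁ hm hp

end Generic

/-! ## §2 Geometry of `□^{(k)}` inside the member `{□_j}` -/

section Geometry

/-- **Both ends of a bond `⟨x, x + e_μ⟩ ⊂ □^{(k)}` lie in `Λ_k = □_k^{(k)}`** (= `cubeLamS … k k`, print's `Λ′_k = □_k^{(k)} ⊇ □^{(k)}`,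
margin `R₁M₁ ≥ 0`). [cite: Balaban1985RegularSpaces, (1.131) p.99 («Λ′_k = □_k^{(k)}»), p.98] -/
theorem mem_cubeLamS_top_of_sq (L : ℕ) (a : Site d) (M ρ k : ℕ) {x : Site d} {μ : Fin d}
    (hx : bLo L a 0 0 ≤ x) (hx' : x + e μ ≤ bHi L a M 0 0) :
    x ∈ cubeLamS L a M ρ k k k ∧ x + e μ ∈ cubeLamS L a M ρ k k k := by
  rw [cubeLamS_self]
  have hxx : x ≤ x + e μ := le_add_of_nonneg_right (B8Lemma1NonAbelian.e_nonneg μ)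
  have h1 : InBox (bLo L a 0 0) (bHi L a M 0 0) x := fun i => ⟨hx i, (hxx i).trans (hx' i)⟩
  have h2 : InBox (bLo L a 0 0) (bHi L a M 0 0) (x + e μ) := fun i => ⟨(hx i).trans (hxx i), hx' i⟩
  simp only [Set.mem_setOf_eq, sqLo, sqHi, Nat.sub_self]
  exact ⟨B8Eq131Cubes.inBox_margin_mono (Nat.zero_le _) h1, B8Eq131Cubes.inBox_margin_mono (Nat.zero_le _) h2⟩

/-- **The fine box `Bᵏ(c₋) ∪ Bᵏ(c₊)` of a bond `c ⊂ □^{(k)}` lies in `□`** (`□ = [Lᵏa, Lᵏ(a + M) − 1]ᵈ` is the union of the `Lᵏ`-blocks over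
`□^{(k)}`). [cite: Balaban1985RegularSpaces, p.98 («we take a size of □ equal to MLʲη»); Balaban1985Averaging, p.24 (the box `Bᵏ(c₋) ∪ Bᵏ(c₊)`)] -/
theorem mem_box_of_bondBox {L : ℕ} (hL : 1 ≤ L) (a : Site d) (M k : ℕ) {x : Site d} {μ : Fin d}
    (hx : bLo L a 0 0 ≤ x) (hx' : x + e μ ≤ bHi L a M 0 0) {z : Site d}
    (hz : InBox (loK L k x) (bondHiK L k x μ) z) : z ∈ box L a M k := by
  intro i
  obtain ⟨h1, h2⟩ := hz i
  have hP : (1 : ℤ) ≤ (L : ℤ) ^ k := one_le_pow₀ (by exact_mod_cast hL)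
  have hxi := hx i
  have hxi' := hx' i
  rw [add_e_apply] at hxi'
  simp only [bLo, bHi, pow_zero, one_mul, Nat.cast_zero, sub_zero, add_zero] at hxi hxi' ⊢
  simp only [loK, bondHiK] at h1 h2
  constructor
  · nlinarith
  · split_ifs at h2 hxi' <;> nlinarith

/-- Hence the fine box of a bond of `□^{(k)}` lies in `Ω_k = □_k ⊇ □` of the member. [cite: Balaban1985RegularSpaces, p.98 («□_k, □»)] -/
theorem mem_cubeFam_top_of_bondBox {L : ℕ} (hL : 1 ≤ L) (a : Site d) (M ρ k : ℕ) {x : Site d} {μ : Fin d}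
    (hx : bLo L a 0 0 ≤ x) (hx' : x + e μ ≤ bHi L a M 0 0) {z : Site d}
    (hz : InBox (loK L k x) (bondHiK L k x μ) z) : z ∈ cubeFam false L a M ρ k k := by
  rw [cubeFam_false_of_le L a M ρ le_rfl]
  exact box_subset_cube_top L a M ρ k (mem_box_of_bondBox hL a M k hx hx' hz)

/-- In dimension `d ≥ 2` every direction has a second one (private plumbing). [folklore] -/
private theorem exists_ne_dir' (hd2 : 2 ≤ d) (μ : Fin d) : ∃ κ : Fin d, κ ≠ μ := by
  by_cases h : (μ : ℕ) = 0
  · exact ⟨⟨1, by omega⟩, fun e => by have := congrArg Fin.val e; simp [h] at this⟩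
  · exact ⟨⟨0, by omega⟩, fun e => by have := congrArg Fin.val e; simp at this; omega⟩

/-- **Every fine bond of the box of a bond of `□^{(k)}` lies on a plaquette touching `□_k`** (`d ≥ 2`; the touching convention of p. 77),
so the (1.62)-shape «on the bonds of the plaquettes touching □_k» applies to it. [cite: Balaban1985RegularSpaces, p.77 (convention before (1.5)), (1.62) p.86, p.98] -/
theorem sideTouches_top_of_bondBox (hd2 : 2 ≤ d) {L : ℕ} (hL : 1 ≤ L) (a : Site d) (M ρ k : ℕ) {x : Site d} {μ : Fin d}
    (hx : bLo L a 0 0 ≤ x) (hx' : x + e μ ≤ bHi L a M 0 0) {z : Site d} {ν : Fin d}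
    (hz : BondIn (loK L k x) (bondHiK L k x μ) z ν) : SideTouches (cubeFam false L a M ρ k k) z ν := by
  obtain ⟨κ, hκ⟩ := exists_ne_dir' hd2 ν
  exact sideTouches_of_bondTouches hκ (Or.inl (mem_cubeFam_top_of_bondBox hL a M ρ k hx hx' hz.1))

end Geometry

/-! ## §3 The identity of (1.137) at the cube member -/

section Member

variable {𝔸 : Type} [CStarAlgebra 𝔸] [Nontrivial 𝔸]

omit [Nontrivial 𝔸] in
/-- The two exponent-field spellings agree bondwise (`B8Prop3GaugeFixedKLevel.expCfg_iEta_eq_cfgExp`; private plumbing). [folklore] -/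
private theorem expCfg_iEta_apply (η : ℝ) (A : Site d → Fin d → 𝔸) (x : Site d) (κ : Fin d) :
    expCfg (iEta η A) x κ = cfgExp η A x κ :=
  congrFun (congrFun (B8Prop3GaugeFixedKLevel.expCfg_iEta_eq_cfgExp η A) x) κ

/-- **THE IDENTITY OF (1.137) «Q_k(ηA) = (1∕i) log Ū₀′ᵏ on □^{(k)}» AT THE CONCRETE CUBE MEMBER, with `Ū₀″ᵏ` on the right** (`= Ū₀′ᵏ` on
`□^{(k)}`, `eq137_cubeMember`).  DATUM: Sect. F's (`L ≥ 2`, `d ≥ 2`, unitary `U₀ ∈ 𝔄_k({Ω_j}, α₀)`, `□̃ ⊂ Ω_{k−1}`, `1 ≤ R₁M₁ = ρ ≤ M`,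
`11d < M`, `k ≥ 1`, the (1.130)-regime — as in `B8Prop6CubeMember.thm4_hypotheses_one_cutFixed`, which supplies (1.132)'s `Ax_k(ℭ_k, 1)` for
`U₀″`).  ON `u`, `A` (any such; at the member they are Theorem 4's, n05-c's `prop6_exists_cubeMember_at`): (1.29) `Restr129 L k (cubeLamS … k) 1 u`;
`U₀″^{u⁻¹} = e^{iηA}` with `|A| ≤ α₂(Lᵏη)⁻¹` on the bonds of the plaquettes touching `□_k` ((1.62)-shape, top level); `16·131072(d+1)²α₂ ≤ 1`,
`2α₂ ≤ c₃(d, L)`.  CONCLUSION: `Q_k(1, iηA)(x, μ) = log Ū₀″ᵏ(x, μ)` for every bond `⟨x, x + e_μ⟩ ⊂ □^{(k)}` (both sides `i`·print's).  PROOF: (87)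
at `x`, `x + e_μ ∈ Λ_k` by `eq87_of_inAx_restr129` (`U₁^{u} = U₀″`), the fine box of the bond inside `□ ⊂ □_k` (§2), and §1. [cite: Balaban1985RegularSpaces, Prop. 6 (1.137) p.99, (1.37) p.82, (1.29) p.81, (1.132) p.99; Balaban1985Averaging, (127) p.37, (87) p.31] -/
theorem logCovIter_eq_mlog_avgIter_cubeMember (hd2 : 2 ≤ d) {L : ℕ} (hL : 2 ≤ L) {k : ℕ} (hk : 1 ≤ k)
    (U₀ : Site d → Fin d → 𝔸ˣ) (hU₀ : ∀ x κ, U₀ x κ ∈ unitaryUnits 𝔸) {α₀ : ℝ} (hα : 0 < α₀)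
    (hα3 : C0 d * (α₀ * (L : ℝ) ^ 2) ≤ 1 / 3) (hα2 : 2 * (α₀ * (L : ℝ) ^ 2) ≤ c2' d L)
    (a : Site d) {M ρ : ℕ} (hρ : 1 ≤ ρ) (hρM : ρ ≤ M) (hM : 11 * (d : ℝ) < M)
    {η : ℝ} (hη : 0 < η) {Ω : ℕ → Set (Site d)} (hA : InAk L k η α₀ Ω U₀) (hT : tcube L a M ρ k ⊆ Ω (k - 1))
    (hsmall : 11 * (d : ℝ) ^ 2 * (L : ℝ) ^ 2 * α₀ + ((M : ℝ) + 4 * ρ) * d * (L : ℝ) ^ 2 * α₀ ≤ 1 / 6)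
    (u : Site d → 𝔸ˣ) (h129 : Restr129 L k (cubeLamS L a M ρ k k) (1 : Site d → Fin d → 𝔸ˣ) u)
    (A : Site d → Fin d → 𝔸) {α₂ : ℝ} (hα₂ : 0 ≤ α₂)
    (h16 : 16 * (131072 * ((d : ℝ) + 1) ^ 2) * α₂ ≤ 1) (hc₃ : 2 * α₂ ≤ c3 d L)
    (h162 : ∀ (z : Site d) (ν : Fin d), SideTouches (cubeFam false L a M ρ k k) z ν →
      gaugeAct u⁻¹ (cutFixed L (tLo a ρ) (tHi a M ρ) U₀ k (ctr a M)) z ν = cfgExp η A z ν ∧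
        ‖A z ν‖ ≤ α₂ * ((L : ℝ) ^ k * η)⁻¹)
    (x : Site d) (μ : Fin d) (hx : bLo L a 0 0 ≤ x) (hx' : x + e μ ≤ bHi L a M 0 0) :
    logCovIter L (1 : Site d → Fin d → 𝔸ˣ) (iEta η A) k x μ =
      mlog ((avgIter L (cutFixed L (tLo a ρ) (tHi a M ρ) U₀ k (ctr a M)) k x μ : 𝔸ˣ) : 𝔸) := by
  have hL1 : 1 ≤ L := le_trans (by norm_num) hL
  have hd1 : 1 ≤ d := le_trans (by norm_num) hd2
  have hG : AvgClosed d L (unitaryUnits 𝔸) := avgClosed_unitaryUnits d L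
  set U'' := cutFixed L (tLo a ρ) (tHi a M ρ) U₀ k (ctr a M) with hU''
  have hgU : gaugeAct u (gaugeAct u⁻¹ U'') = U'' := by rw [← gaugeAct_mul, mul_inv_cancel, gaugeAct_one]
  -- (1.132)'s axial class for `U₀″` at the member, and (87) at the sites of `Λ_k`
  obtain ⟨-, -, -, hAx, -, -⟩ := thm4_hypotheses_one_cutFixed L hL hd1 k U₀ hU₀ hα hα3 hα2 a hρ hρM hM hη hA hT hsmall
  have hAx' : InAx L k (cubeLamS L a M ρ k k) (1 : Site d → Fin d → 𝔸ˣ)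
      (mgauge (1 : Site d → Fin d → 𝔸ˣ) u (gaugeAct u⁻¹ U'') * (1 : Site d → Fin d → 𝔸ˣ)) := by
    rw [mgauge_one_left, hgU]
    exact hAx k le_rfl
  have h87 := eq87_of_inAx_restr129 L hL1 k (cubeLamS L a M ρ k k) (1 : Site d → Fin d → 𝔸ˣ) (gaugeAct u⁻¹ U'') u hAx' h129
  obtain ⟨hxΛ, hxΛ'⟩ := mem_cubeLamS_top_of_sq L a M ρ k hx hx'
  have hm := h87 k le_rfl x hxΛ
  have hp := h87 k le_rfl (x + e μ) hxΛ'
  obtain ⟨j, rfl⟩ : ∃ j, k = j + 1 := ⟨k - 1, by omega⟩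
  -- on the fine box of the bond: `U₁ = e^{iηA}`, `‖iηA‖ ≤ α₂L^{−k}`
  set b : ℝ := α₂ * ((L : ℝ) ^ (j + 1))⁻¹ with hb_def
  have hLpos : (0 : ℝ) < L := by exact_mod_cast hL1
  have hb0 : 0 ≤ b := by positivity
  have hLb : (L : ℝ) ^ (j + 1) * b = α₂ := by rw [hb_def]; field_simp
  have hbox : ∀ z ν, BondIn (loK L (j + 1) x) (bondHiK L (j + 1) x μ) z ν →
      gaugeAct u⁻¹ U'' z ν = expCfg (iEta η A) z ν ∧ ‖iEta η A z ν‖ ≤ b := by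
    intro z ν hz
    obtain ⟨hW, hAz⟩ := h162 z ν (sideTouches_top_of_bondBox hd2 hL1 a M ρ (j + 1) hx hx' hz)
    refine ⟨by rw [expCfg_iEta_apply]; exact hW, ?_⟩
    have hLj : (0 : ℝ) < (L : ℝ) ^ (j + 1) := by positivity
    show ‖((I : ℂ) * η) • A z ν‖ ≤ b
    rw [norm_smul, norm_mul, Complex.norm_I, one_mul, Complex.norm_real, Real.norm_eq_abs, abs_of_pos hη, hb_def]
    calc η * ‖A z ν‖ ≤ η * (α₂ * ((L : ℝ) ^ (j + 1) * η)⁻¹) := mul_le_mul_of_nonneg_left hAz hη.le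
      _ = α₂ * ((L : ℝ) ^ (j + 1))⁻¹ := by field_simp
  have hU₁E : AgreeOn (loK L (j + 1) x) (bondHiK L (j + 1) x μ) (gaugeAct u⁻¹ U'') (expCfg (iEta η A)) :=
    fun z ν hz hzν => (hbox z ν ⟨hz, hzν⟩).1
  have hB : ∀ z ν, BondIn (loK L (j + 1) x) (bondHiK L (j + 1) x μ) z ν → ‖iEta η A z ν‖ ≤ b :=
    fun z ν hz => (hbox z ν hz).2
  have key := logCovIter_one_eq_mlog_avgIter_loc_of_window L hL hG j x μ (iEta η A) hb0 hB (by rw [hLb]; exact h16)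
    (by rw [hLb]; exact hc₃) u (gaugeAct u⁻¹ U'') hU₁E hm hp
  rwa [hgU] at key

/-- **(1.137) COMPLETE AT THE CONCRETE CUBE MEMBER** (p. 99): under the datum of `logCovIter_eq_mlog_avgIter_cubeMember` together with
«`□ ⊂ Ω_k`» (p. 98) and `dMα₀ ≤ 1∕2`, for every bond `⟨x, x + e_μ⟩ ⊂ □^{(k)}`:
`Q_k(1, iηA)(x, μ) = log Ū₀′ᵏ(x, μ)` (the identity, `U₀′ = U₀^{v}`, `v = localGauge …` the gauge of p. 98), `Ū₀″ᵏ(x, μ) = Ū₀′ᵏ(x, μ)`, and the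
inequalities `‖(1∕i) log Ū₀′ᵏ(x, x + e_μ)‖ ≤ |x − y|₁·4α₀ ≤ 2dMα₀`, `y = ctr a M` (`B8Prop6OfThm4.ineq137_cube` by name).
[cite: Balaban1985RegularSpaces, Prop. 6 (1.137) p.99, (1.128)–(1.129) p.98, (1.37) p.82; Balaban1985Averaging, (127) p.37, Prop. 2 p.26] -/
theorem eq137_cubeMember (hd2 : 2 ≤ d) {L : ℕ} (hL : 2 ≤ L) {k : ℕ} (hk : 1 ≤ k)
    (U₀ : Site d → Fin d → 𝔸ˣ) (hU₀ : ∀ x κ, U₀ x κ ∈ unitaryUnits 𝔸) {α₀ : ℝ} (hα : 0 < α₀)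
    (hα3 : C0 d * (α₀ * (L : ℝ) ^ 2) ≤ 1 / 3) (hα2 : 2 * (α₀ * (L : ℝ) ^ 2) ≤ c2' d L)
    (a : Site d) {M ρ : ℕ} (hρ : 1 ≤ ρ) (hρM : ρ ≤ M) (hM : 11 * (d : ℝ) < M)
    {η : ℝ} (hη : 0 < η) {Ω : ℕ → Set (Site d)} (hA : InAk L k η α₀ Ω U₀) (hT : tcube L a M ρ k ⊆ Ω (k - 1))
    (hΩk : box L a M k ⊆ Ω k)
    (hsmall : 11 * (d : ℝ) ^ 2 * (L : ℝ) ^ 2 * α₀ + ((M : ℝ) + 4 * ρ) * d * (L : ℝ) ^ 2 * α₀ ≤ 1 / 6)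
    (hsmall' : (d : ℝ) * M * α₀ ≤ 1 / 2)
    (u : Site d → 𝔸ˣ) (h129 : Restr129 L k (cubeLamS L a M ρ k k) (1 : Site d → Fin d → 𝔸ˣ) u)
    (A : Site d → Fin d → 𝔸) {α₂ : ℝ} (hα₂ : 0 ≤ α₂)
    (h16 : 16 * (131072 * ((d : ℝ) + 1) ^ 2) * α₂ ≤ 1) (hc₃ : 2 * α₂ ≤ c3 d L)
    (h162 : ∀ (z : Site d) (ν : Fin d), SideTouches (cubeFam false L a M ρ k k) z ν →
      gaugeAct u⁻¹ (cutFixed L (tLo a ρ) (tHi a M ρ) U₀ k (ctr a M)) z ν = cfgExp η A z ν ∧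
        ‖A z ν‖ ≤ α₂ * ((L : ℝ) ^ k * η)⁻¹)
    (x : Site d) (μ : Fin d) (hx : bLo L a 0 0 ≤ x) (hx' : x + e μ ≤ bHi L a M 0 0) :
    logCovIter L (1 : Site d → Fin d → 𝔸ˣ) (iEta η A) k x μ =
        mlog ((avgIter L (gaugeAct (localGauge L (tLo a ρ) (tHi a M ρ) U₀ k (ctr a M)) U₀) k x μ : 𝔸ˣ) : 𝔸) ∧
      avgIter L (cutFixed L (tLo a ρ) (tHi a M ρ) U₀ k (ctr a M)) k x μ =
        avgIter L (gaugeAct (localGauge L (tLo a ρ) (tHi a M ρ) U₀ k (ctr a M)) U₀) k x μ ∧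
      ‖(Complex.I⁻¹ : ℂ) •
          mlog ((avgIter L (gaugeAct (localGauge L (tLo a ρ) (tHi a M ρ) U₀ k (ctr a M)) U₀) k x μ : 𝔸ˣ) : 𝔸)‖
        ≤ l1 (x - ctr a M) * (4 * α₀) ∧
      (l1 (x - ctr a M) : ℝ) * (4 * α₀) ≤ 2 * d * M * α₀ := by
  have hM1 : 1 ≤ M := hρ.trans hρM
  have hG : AvgClosed d L (unitaryUnits 𝔸) := avgClosed_unitaryUnits d L
  obtain ⟨e1, h2, h3⟩ := ineq137_cube L hL hG k U₀ hU₀ hα hα3 hα2 a ρ hM1 hA hT hΩk hsmall' x μ hx hx'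
  have hid := logCovIter_eq_mlog_avgIter_cubeMember hd2 hL hk U₀ hU₀ hα hα3 hα2 a hρ hρM hM hη hA hT hsmall u h129 A hα₂
    h16 hc₃ h162 x μ hx hx'
  rw [e1] at hid
  exact ⟨hid, e1, h2, h3⟩

end Member

end Literature.MathematicalPhysics.QuantumFieldTheory.Balaban1983to89.B8Prop6CubeMemberEq137

end
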